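import Literature.NumberTheory.EllipticCurves.Curve8x121SelmerCertificatesA
import HarnessLib

/-!
# Everywhere-locally-soluble classes of `S(-16, -420)`, second part (classes `[-5, 6, -6, 7]`)

Topic `NumberTheory/EllipticCurves`. Continuation of `Curve8x121SelmerCertificatesA` (same method and helpers: explicit real, `ℚ₂`-, and
`ℚ_q`-points at the primes `q ∣ Δ`, good reduction elsewhere; Silverman, AEC X.6.5(a); Bhargava–Shankar Prop. 5.13). Theorems only.

## References

* [SilvermanAEC2009] J. H. Silverman, *AEC*, 2nd ed.: Prop. X.4.9, Prop. X.6.5(a).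
* [BhargavaShankarAnnals2015] M. Bhargava, A. Shankar, Ann. of Math. 181 (2015), Prop. 5.13.
-/

noncomputable section

open scoped Classical

namespace Literature.NumberTheory.EllipticCurves

namespace Curve8x121

open Literature.NumberTheory.DiophantineGeometry.LindMordellQuartics (exists_sq_eq_intCast)

/-- Squarefreeness of a (small) integer from the factorisation of its absolute value. [folklore] -/
private theorem squarefree_int_of_natAbs {d : ℤ} {n : ℕ} (h : d.natAbs = n) (hn : n ≠ 0)
    (hnd : n.primeFactorsList.Nodup) : Squarefree d :=
  Int.squarefree_natAbs.mp (h ▸ (Nat.squarefree_iff_nodup_primeFactorsList hn).mpr hnd)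

/-! ## The certificates (second part) -/

/-- **`C_{-5} : w² = -5u⁴ + -16u²z² + (84)z⁴` is everywhere locally soluble**: real point `(0, 1)` (value `84`); `ℚ₂`-point `(2, 1)` (value `2²·(-15)`, `-15 ≡ 1 (mod 8)`); `ℚ_{3}`-point `(1, 0)` (value `1²·(-5)`, `≡ 1² (mod 3)`); `ℚ_{5}`-point `(0, 1)` (value `1²·(84)`, `≡ 2² (mod 5)`); `ℚ_{7}`-point `(1, 0)` (value `1²·(-5)`, `≡ 3² (mod 7)`); `ℚ_{11}`-point `(3, 2)` (value `11²·(3)`, `≡ 5² (mod 11)`); good reduction at the other primes.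
[cite: SilvermanAEC2009, Prop. X.6.5(a) (the method: local points by Hensel's lemma)]
[cite: BhargavaShankarAnnals2015, Prop. 5.13 (good reduction implies local solubility)] -/
theorem isLocallySoluble_C_m5 : (twoIsogenyQuartic (-16) (-5) (84)).IsLocallySoluble := by
  refine ⟨isSoluble_real_of_pos (u := 0) (z := 1) (v := 84) (Or.inr (by norm_num)) (by norm_num) (by norm_num),
    fun p hp => ?_⟩
  have hP : p.Prime := hp.out
  by_cases hdvd : (p : ℤ) ∣ -25187205120
  · rcases prime_dvd_disc_cases hP hdvd with rfl | rfl | rfl | rfl | rfl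
    · obtain ⟨r, hr⟩ := Curve346.exists_sq_eq_two (c := -15) (by decide)
      exact isSoluble_padic_of_sq (u := 2) (z := 1) (k := 2) (Or.inl (by norm_num)) (by norm_num) hr
    · obtain ⟨r, hr⟩ := exists_sq_eq_intCast (q := 3) (by norm_num) (c := -5) (w := 1) (by norm_num) (by norm_num)
      exact isSoluble_padic_of_sq (u := 1) (z := 0) (k := 1) (Or.inl (by norm_num)) (by norm_num) hr
    · obtain ⟨r, hr⟩ := exists_sq_eq_intCast (q := 5) (by norm_num) (c := 84) (w := 2) (by norm_num) (by norm_num)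
      exact isSoluble_padic_of_sq (u := 0) (z := 1) (k := 1) (Or.inr (by norm_num)) (by norm_num) hr
    · obtain ⟨r, hr⟩ := exists_sq_eq_intCast (q := 7) (by norm_num) (c := -5) (w := 3) (by norm_num) (by norm_num)
      exact isSoluble_padic_of_sq (u := 1) (z := 0) (k := 1) (Or.inl (by norm_num)) (by norm_num) hr
    · obtain ⟨r, hr⟩ := exists_sq_eq_intCast (q := 11) (by norm_num) (c := 3) (w := 5) (by norm_num) (by norm_num)
      exact isSoluble_padic_of_sq (u := 3) (z := 2) (k := 11) (Or.inl (by norm_num)) (by norm_num) hr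
  · exact BinaryQuartic.isSoluble_padic_of_not_dvd_disc (five_le_of_not_dvd_disc hP hdvd) _
      (by rw [disc_C (-5) (84) (by norm_num)]; exact hdvd)

/-- **`C_{6} : w² = 6u⁴ + -16u²z² + (-70)z⁴` is everywhere locally soluble**: real point `(1, 0)` (value `6`); `ℚ₂`-point `(3, 1)` (value `4²·(17)`, `17 ≡ 1 (mod 8)`); `ℚ_{3}`-point `(1, 1)` (value `1²·(-80)`, `≡ 1² (mod 3)`); `ℚ_{5}`-point `(1, 0)` (value `1²·(6)`, `≡ 1² (mod 5)`); `ℚ_{7}`-point `(1, 1)` (value `1²·(-80)`, `≡ 2² (mod 7)`); `ℚ_{11}`-point `(3, 2)` (value `11²·(-10)`, `≡ 1² (mod 11)`); good reduction at the other primes.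
[cite: SilvermanAEC2009, Prop. X.6.5(a) (the method: local points by Hensel's lemma)]
[cite: BhargavaShankarAnnals2015, Prop. 5.13 (good reduction implies local solubility)] -/
theorem isLocallySoluble_C_6 : (twoIsogenyQuartic (-16) (6) (-70)).IsLocallySoluble := by
  refine ⟨isSoluble_real_of_pos (u := 1) (z := 0) (v := 6) (Or.inl (by norm_num)) (by norm_num) (by norm_num),
    fun p hp => ?_⟩
  have hP : p.Prime := hp.out
  by_cases hdvd : (p : ℤ) ∣ -25187205120
  · rcases prime_dvd_disc_cases hP hdvd with rfl | rfl | rfl | rfl | rfl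
    · obtain ⟨r, hr⟩ := Curve346.exists_sq_eq_two (c := 17) (by decide)
      exact isSoluble_padic_of_sq (u := 3) (z := 1) (k := 4) (Or.inl (by norm_num)) (by norm_num) hr
    · obtain ⟨r, hr⟩ := exists_sq_eq_intCast (q := 3) (by norm_num) (c := -80) (w := 1) (by norm_num) (by norm_num)
      exact isSoluble_padic_of_sq (u := 1) (z := 1) (k := 1) (Or.inl (by norm_num)) (by norm_num) hr
    · obtain ⟨r, hr⟩ := exists_sq_eq_intCast (q := 5) (by norm_num) (c := 6) (w := 1) (by norm_num) (by norm_num)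
      exact isSoluble_padic_of_sq (u := 1) (z := 0) (k := 1) (Or.inl (by norm_num)) (by norm_num) hr
    · obtain ⟨r, hr⟩ := exists_sq_eq_intCast (q := 7) (by norm_num) (c := -80) (w := 2) (by norm_num) (by norm_num)
      exact isSoluble_padic_of_sq (u := 1) (z := 1) (k := 1) (Or.inl (by norm_num)) (by norm_num) hr
    · obtain ⟨r, hr⟩ := exists_sq_eq_intCast (q := 11) (by norm_num) (c := -10) (w := 1) (by norm_num) (by norm_num)
      exact isSoluble_padic_of_sq (u := 3) (z := 2) (k := 11) (Or.inl (by norm_num)) (by norm_num) hr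
  · exact BinaryQuartic.isSoluble_padic_of_not_dvd_disc (five_le_of_not_dvd_disc hP hdvd) _
      (by rw [disc_C (6) (-70) (by norm_num)]; exact hdvd)

/-- **`C_{-6} : w² = -6u⁴ + -16u²z² + (70)z⁴` is everywhere locally soluble**: real point `(0, 1)` (value `70`); `ℚ₂`-point `(1, 3)` (value `4²·(345)`, `345 ≡ 1 (mod 8)`); `ℚ_{3}`-point `(0, 1)` (value `1²·(70)`, `≡ 1² (mod 3)`); `ℚ_{5}`-point `(1, 0)` (value `1²·(-6)`, `≡ 2² (mod 5)`); `ℚ_{7}`-point `(1, 0)` (value `1²·(-6)`, `≡ 1² (mod 7)`); `ℚ_{11}`-point `(0, 1)` (value `1²·(70)`, `≡ 2² (mod 11)`); good reduction at the other primes.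
[cite: SilvermanAEC2009, Prop. X.6.5(a) (the method: local points by Hensel's lemma)]
[cite: BhargavaShankarAnnals2015, Prop. 5.13 (good reduction implies local solubility)] -/
theorem isLocallySoluble_C_m6 : (twoIsogenyQuartic (-16) (-6) (70)).IsLocallySoluble := by
  refine ⟨isSoluble_real_of_pos (u := 0) (z := 1) (v := 70) (Or.inr (by norm_num)) (by norm_num) (by norm_num),
    fun p hp => ?_⟩
  have hP : p.Prime := hp.out
  by_cases hdvd : (p : ℤ) ∣ -25187205120
  · rcases prime_dvd_disc_cases hP hdvd with rfl | rfl | rfl | rfl | rfl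
    · obtain ⟨r, hr⟩ := Curve346.exists_sq_eq_two (c := 345) (by decide)
      exact isSoluble_padic_of_sq (u := 1) (z := 3) (k := 4) (Or.inl (by norm_num)) (by norm_num) hr
    · obtain ⟨r, hr⟩ := exists_sq_eq_intCast (q := 3) (by norm_num) (c := 70) (w := 1) (by norm_num) (by norm_num)
      exact isSoluble_padic_of_sq (u := 0) (z := 1) (k := 1) (Or.inr (by norm_num)) (by norm_num) hr
    · obtain ⟨r, hr⟩ := exists_sq_eq_intCast (q := 5) (by norm_num) (c := -6) (w := 2) (by norm_num) (by norm_num)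
      exact isSoluble_padic_of_sq (u := 1) (z := 0) (k := 1) (Or.inl (by norm_num)) (by norm_num) hr
    · obtain ⟨r, hr⟩ := exists_sq_eq_intCast (q := 7) (by norm_num) (c := -6) (w := 1) (by norm_num) (by norm_num)
      exact isSoluble_padic_of_sq (u := 1) (z := 0) (k := 1) (Or.inl (by norm_num)) (by norm_num) hr
    · obtain ⟨r, hr⟩ := exists_sq_eq_intCast (q := 11) (by norm_num) (c := 70) (w := 2) (by norm_num) (by norm_num)
      exact isSoluble_padic_of_sq (u := 0) (z := 1) (k := 1) (Or.inr (by norm_num)) (by norm_num) hr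
  · exact BinaryQuartic.isSoluble_padic_of_not_dvd_disc (five_le_of_not_dvd_disc hP hdvd) _
      (by rw [disc_C (-6) (70) (by norm_num)]; exact hdvd)

/-- **`C_{7} : w² = 7u⁴ + -16u²z² + (-60)z⁴` is everywhere locally soluble**: real point `(1, 0)` (value `7`); `ℚ₂`-point `(0, 1)` (value `2²·(-15)`, `-15 ≡ 1 (mod 8)`); `ℚ_{3}`-point `(1, 0)` (value `1²·(7)`, `≡ 1² (mod 3)`); `ℚ_{5}`-point `(1, 1)` (value `1²·(-69)`, `≡ 1² (mod 5)`); `ℚ_{7}`-point `(1, 1)` (value `1²·(-69)`, `≡ 1² (mod 7)`); `ℚ_{11}`-point `(3, 1)` (value `11²·(3)`, `≡ 5² (mod 11)`); good reduction at the other primes.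
[cite: SilvermanAEC2009, Prop. X.6.5(a) (the method: local points by Hensel's lemma)]
[cite: BhargavaShankarAnnals2015, Prop. 5.13 (good reduction implies local solubility)] -/
theorem isLocallySoluble_C_7 : (twoIsogenyQuartic (-16) (7) (-60)).IsLocallySoluble := by
  refine ⟨isSoluble_real_of_pos (u := 1) (z := 0) (v := 7) (Or.inl (by norm_num)) (by norm_num) (by norm_num),
    fun p hp => ?_⟩
  have hP : p.Prime := hp.out
  by_cases hdvd : (p : ℤ) ∣ -25187205120
  · rcases prime_dvd_disc_cases hP hdvd with rfl | rfl | rfl | rfl | rfl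
    · obtain ⟨r, hr⟩ := Curve346.exists_sq_eq_two (c := -15) (by decide)
      exact isSoluble_padic_of_sq (u := 0) (z := 1) (k := 2) (Or.inr (by norm_num)) (by norm_num) hr
    · obtain ⟨r, hr⟩ := exists_sq_eq_intCast (q := 3) (by norm_num) (c := 7) (w := 1) (by norm_num) (by norm_num)
      exact isSoluble_padic_of_sq (u := 1) (z := 0) (k := 1) (Or.inl (by norm_num)) (by norm_num) hr
    · obtain ⟨r, hr⟩ := exists_sq_eq_intCast (q := 5) (by norm_num) (c := -69) (w := 1) (by norm_num) (by norm_num)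
      exact isSoluble_padic_of_sq (u := 1) (z := 1) (k := 1) (Or.inl (by norm_num)) (by norm_num) hr
    · obtain ⟨r, hr⟩ := exists_sq_eq_intCast (q := 7) (by norm_num) (c := -69) (w := 1) (by norm_num) (by norm_num)
      exact isSoluble_padic_of_sq (u := 1) (z := 1) (k := 1) (Or.inl (by norm_num)) (by norm_num) hr
    · obtain ⟨r, hr⟩ := exists_sq_eq_intCast (q := 11) (by norm_num) (c := 3) (w := 5) (by norm_num) (by norm_num)
      exact isSoluble_padic_of_sq (u := 3) (z := 1) (k := 11) (Or.inl (by norm_num)) (by norm_num) hr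
  · exact BinaryQuartic.isSoluble_padic_of_not_dvd_disc (five_le_of_not_dvd_disc hP hdvd) _
      (by rw [disc_C (7) (-60) (by norm_num)]; exact hdvd)

/-- `-5 ∈ S(-16, -420)`. [cite: SilvermanAEC2009, Prop. X.4.9] -/
theorem mem_S_m5 : (-5 : ℤ) ∈ twoIsogenySelmerGroup (-16) (-420) :=
  (mem_twoIsogenySelmerGroup_iff (by norm_num)).mpr
    ⟨squarefree_int_of_natAbs (n := 5) rfl (by norm_num) (by simp), by norm_num,
      by rw [show (-420 : ℤ) / -5 = 84 by norm_num]; exact isLocallySoluble_C_m5⟩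

/-- `6 ∈ S(-16, -420)`. [cite: SilvermanAEC2009, Prop. X.4.9] -/
theorem mem_S_6 : (6 : ℤ) ∈ twoIsogenySelmerGroup (-16) (-420) :=
  (mem_twoIsogenySelmerGroup_iff (by norm_num)).mpr
    ⟨squarefree_int_of_natAbs (n := 6) rfl (by norm_num) (by simp), by norm_num,
      by rw [show (-420 : ℤ) / 6 = -70 by norm_num]; exact isLocallySoluble_C_6⟩

/-- `-6 ∈ S(-16, -420)`. [cite: SilvermanAEC2009, Prop. X.4.9] -/
theorem mem_S_m6 : (-6 : ℤ) ∈ twoIsogenySelmerGroup (-16) (-420) :=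
  (mem_twoIsogenySelmerGroup_iff (by norm_num)).mpr
    ⟨squarefree_int_of_natAbs (n := 6) rfl (by norm_num) (by simp), by norm_num,
      by rw [show (-420 : ℤ) / -6 = 70 by norm_num]; exact isLocallySoluble_C_m6⟩

/-- `7 ∈ S(-16, -420)`. [cite: SilvermanAEC2009, Prop. X.4.9] -/
theorem mem_S_7 : (7 : ℤ) ∈ twoIsogenySelmerGroup (-16) (-420) :=
  (mem_twoIsogenySelmerGroup_iff (by norm_num)).mpr
    ⟨squarefree_int_of_natAbs (n := 7) rfl (by norm_num) (by simp), by norm_num,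
      by rw [show (-420 : ℤ) / 7 = -60 by norm_num]; exact isLocallySoluble_C_7⟩


end Curve8x121

end Literature.NumberTheory.EllipticCurves

end
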